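import Literature.AlgebraicTopology.Homotopy.SerreFibrationSequence
import Literature.AlgebraicTopology.Homotopy.HomotopyGroupsGeneralPosition
import Mathlib.Topology.Homotopy.Lifting
import Mathlib.Topology.Covering.AddCircle
import Mathlib.Topology.Instances.ZMultiples
import Mathlib.Analysis.Convex.Contractible
import HarnessLib

/-!
# Covering maps are Serre fibrations; `πₙ(S¹) = 0` for `n ≥ 2`

Topic `Literature/AlgebraicTopology/Homotopy`. A. Hatcher, *Algebraic Topology* (2002), §4.2,
Prop. 4.48 / Prop. 1.30 (the homotopy lifting property of covering spaces: "a covering map is a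
fibration"), and the long exact sequence of a fibration, Thm. 4.41, Example 4.44's predecessor
p. 342 / Prop. 4.1: "`πₙ(X̃) → πₙ(X)` is an isomorphism for `n ≥ 2` … In particular `πₙ(S¹) = 0`
for `n ≥ 2` since the universal cover `ℝ` is contractible." PROVED here, from Mathlib's homotopy
lifting for covering maps (`IsCoveringMap.liftHomotopy`, J. Xu) and the tree's Serre-fibration
sequence (`SerreFibrationSequence.lean`):

* `IsCoveringMap.isSerreFibration` — **a covering map is a Serre fibration** (relative cube form:
  the lifted homotopy agrees with any prescribed lift on `I × ∂Iᵐ` by uniqueness of path lifting);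
* `subsingleton_homotopyGroup_of_discreteTopology` — `π_N` of a discrete space is trivial
  (`N` nonempty);
* `IsCoveringMap.injective_homotopyGroupMap`, `…surjective_homotopyGroupMap` — for a covering
  `p : E → B`, `p_* : π_N(E, e) → π_N(B, p e)` is one-to-one for `|N| ≥ 1` and onto for `|N| ≥ 2`;
* **`AddCircle.subsingleton_homotopyGroup`** — `π_N(ℝ/qℤ, x) = 0` for `|N| ≥ 2`
  (universal cover `ℝ → ℝ/qℤ`, Mathlib `AddCircle.isCoveringMap_coe`, `ℝ` contractible).

Everything is proved; no named facts.

## References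

* A. Hatcher, *Algebraic Topology*, CUP (2002), Prop. 1.30, Prop. 4.1, §4.2 Thm. 4.41,
  Prop. 4.48. [HatcherAT2002]
-/

noncomputable section

open Set Function Topology unitInterval
open scoped Topology.Homotopy unitInterval

namespace Literature.AlgebraicTopology.Homotopy

universe u v

variable {E : Type u} {B : Type v} [TopologicalSpace E] [TopologicalSpace B] {p : E → B}

/-! ### Covering maps are Serre fibrations -/

/-- **A covering map is a Serre fibration** (Hatcher 2002, Prop. 4.48 (covering spaces are fibre
bundles with discrete fibre) / Prop. 1.30 (homotopy lifting)): lift the homotopy from its initial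
lift (Mathlib `IsCoveringMap.liftHomotopy`); on `I × ∂Iᵐ` the lift agrees with the prescribed one
by uniqueness of lifted paths. [cite: HatcherAT2002, Prop. 1.30, §4.2 Prop. 4.48] -/
theorem _root_.IsCoveringMap.isSerreFibration (cov : IsCoveringMap p) : IsSerreFibration p := by
  refine ⟨cov.continuous, fun m K g hg hgK => ?_⟩
  have h0mem : ∀ y : Fin m → I, ((0 : I), y) ∈ relLiftSource (Fin m) := fun y =>
    mem_relLiftSource.2 (Or.inl rfl)
  let f : C(Fin m → I, E) :=
    ⟨fun y => g (0, y), hg.comp_continuous (continuous_const.prodMk continuous_id) h0mem⟩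
  have H0 : ∀ y, K (0, y) = p (f y) := fun y => (hgK _ (h0mem y)).symm
  refine ⟨cov.liftHomotopy K f H0, fun z => congr_fun (cov.liftHomotopy_lifts K f H0) z, ?_⟩
  rintro ⟨t, y⟩ hz
  rcases mem_relLiftSource.1 hz with h1 | h2
  · have ht : t = 0 := h1
    subst ht
    exact cov.liftHomotopy_zero K f H0 y
  · -- both `s ↦ G (s, y)` and `s ↦ g (s, y)` lift `s ↦ K (s, y)` from `g (0, y)`
    have hmem : ∀ s : I, (s, y) ∈ relLiftSource (Fin m) := fun s => mem_relLiftSource.2 (Or.inr h2)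
    let γ : C(I, B) := ⟨fun s => K (s, y), K.continuous.comp (continuous_id.prodMk continuous_const)⟩
    have e0 : γ 0 = p (f y) := H0 y
    have hG : (fun s => cov.liftHomotopy K f H0 (s, y)) = cov.liftPath γ (f y) e0 :=
      (cov.eq_liftPath_iff _).2 ⟨(cov.liftHomotopy K f H0).continuous.comp
        (continuous_id.prodMk continuous_const),
        funext fun s => congr_fun (cov.liftHomotopy_lifts K f H0) (s, y), cov.liftHomotopy_zero K f H0 y⟩
    have hg' : (fun s => g (s, y)) = cov.liftPath γ (f y) e0 :=
      (cov.eq_liftPath_iff _).2 ⟨hg.comp_continuous (continuous_id.prodMk continuous_const) hmem,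
        funext fun s => hgK _ (hmem s), rfl⟩
    exact (congr_fun hG t).trans (congr_fun hg' t).symm

/-! ### Homotopy groups of discrete spaces -/

/-- **`π_N` of a discrete space is trivial** (`N` nonempty): a map of the connected cube is
constant, equal to its boundary value. [folklore] -/
theorem subsingleton_homotopyGroup_of_discreteTopology {N : Type*} {F : Type*} [TopologicalSpace F]
    [DiscreteTopology F] [Nonempty N] (x : F) : Subsingleton (HomotopyGroup N F x) := by
  have key : ∀ r : Ω^ N F x, r = GenLoop.const := fun r => by
    refine GenLoop.ext _ _ fun y => ?_
    obtain ⟨i⟩ := ‹Nonempty N›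
    have hc : (fun _ => 0 : N → I) ∈ Cube.boundary N := ⟨i, Or.inl rfl⟩
    have h1 : r y = r (fun _ => 0) := PreconnectedSpace.constant inferInstance r.1.continuous
    exact h1.trans (r.2 _ hc)
  refine ⟨fun a b => ?_⟩
  induction a using Quotient.inductionOn with
  | h q =>
    induction b using Quotient.inductionOn with
    | h q' => rw [key q, key q']

/-! ### `p_*` for a covering map -/

section Covering

variable {N : Type*} [DecidableEq N] [Fintype N]

/-- **`p_*` is one-to-one on `π_N`, `|N| ≥ 1`, for a covering map** (exactness at `π_N(E)`: the
fibre is discrete, so `π_N(F) = 0`). [cite: HatcherAT2002, Prop. 4.1] -/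
theorem _root_.IsCoveringMap.injective_homotopyGroupMap (cov : IsCoveringMap p) [Nonempty N] (e : E) :
    Injective (homotopyGroupMap (N := N) ⟨p, cov.continuous⟩ e) := by
  obtain ⟨s⟩ := ‹Nonempty N›
  haveI : DiscreteTopology ↥(fibre p e) := (cov (p e)).1
  haveI : Subsingleton (HomotopyGroup N ↥(fibre p e) (fibreBase p e)) :=
    subsingleton_homotopyGroup_of_discreteTopology _
  -- `p_*` is a homomorphism with trivial kernel
  have hker : ∀ b : HomotopyGroup N E e, homotopyGroupMap (N := N) ⟨p, cov.continuous⟩ e b = ⟦GenLoop.const⟧ →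
      b = ⟦GenLoop.const⟧ := fun b hb => by
    obtain ⟨c, rfl⟩ := cov.isSerreFibration.exists_homotopyGroupIncl_eq s e b hb
    rw [Subsingleton.elim c ⟦GenLoop.const⟧]
    rfl
  intro a b hab
  have h := (homotopyGroupMapHom (N := N) ⟨p, cov.continuous⟩ e).map_mul a⁻¹ b
  have h1 : homotopyGroupMap (N := N) ⟨p, cov.continuous⟩ e (a⁻¹ * b) = ⟦GenLoop.const⟧ := by
    rw [← coe_homotopyGroupMapHom, map_mul, map_inv, coe_homotopyGroupMapHom, hab, inv_mul_cancel,
      HomotopyGroup.one_def]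
  have h2 := hker _ h1
  rw [← HomotopyGroup.one_def] at h2
  exact inv_mul_eq_one.1 h2

/-- **`p_*` is onto on `π_N`, `|N| ≥ 2`, for a covering map** (exactness at `π_N(B)`: `δ` lands
in `π_{N∖s}(F) = 0`, the fibre being discrete and `N ∖ s` nonempty). [cite: HatcherAT2002, Prop. 4.1] -/
theorem _root_.IsCoveringMap.surjective_homotopyGroupMap (cov : IsCoveringMap p) (hN : 2 ≤ Fintype.card N)
    (e : E) : Surjective (homotopyGroupMap (N := N) ⟨p, cov.continuous⟩ e) := by
  obtain ⟨s, s', hss'⟩ : ∃ s s' : N, s ≠ s' := Fintype.exists_pair_of_one_lt_card (by omega)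
  haveI : Nonempty { j // j ≠ s } := ⟨⟨s', fun h => hss' h.symm⟩⟩
  haveI : DiscreteTopology ↥(fibre p e) := (cov (p e)).1
  haveI : Subsingleton (HomotopyGroup { j // j ≠ s } ↥(fibre p e) (fibreBase p e)) :=
    subsingleton_homotopyGroup_of_discreteTopology _
  intro b
  exact cov.isSerreFibration.exists_proj_eq s e b (Subsingleton.elim _ _)

end Covering

/-! ### `πₙ(S¹) = 0` for `n ≥ 2` -/

/-- **`π_N(ℝ/qℤ, x) = 0` for `|N| ≥ 2`** (Hatcher 2002, Prop. 4.1: the universal cover `ℝ` is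
contractible and `p_*` is onto for `n ≥ 2`). [cite: HatcherAT2002, Prop. 4.1] -/
theorem AddCircle.subsingleton_homotopyGroup {q : ℝ} {N : Type*} [DecidableEq N] [Fintype N]
    (hN : 2 ≤ Fintype.card N) (x : AddCircle q) : Subsingleton (HomotopyGroup N (AddCircle q) x) := by
  have cov : IsCoveringMap ((↑) : ℝ → AddCircle q) := AddCircle.isCoveringMap_coe q
  obtain ⟨e, rfl⟩ : ∃ e : ℝ, (e : AddCircle q) = x := QuotientAddGroup.mk_surjective x
  -- `π_N(ℝ) = 0`: `ℝ` is contractible (the tree's general statement lives in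
  -- `Literature/Geometry/Symplectic/GromovR4Proofs.lean`, outside this import cone)
  haveI : Subsingleton (HomotopyGroup N ℝ e) := by
    refine subsingleton_homotopyGroup_of_homotopyEquiv (ContractibleSpace.hequiv_unit ℝ).some
      (fun u => ⟨fun a b => ?_⟩) e
    induction a using Quotient.inductionOn with
    | h q =>
      induction b using Quotient.inductionOn with
      | h q' => exact congrArg _ (GenLoop.ext _ _ fun _ => Subsingleton.elim _ _)
  exact (cov.surjective_homotopyGroupMap hN e).subsingleton

end Literature.AlgebraicTopology.Homotopy

end
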